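import Summits.Parity.GeneralizedHardyLittlewood.Theorems.GreenTaoLevelTwoMNTwoDivisorPacking
import Summits.Parity.GeneralizedHardyLittlewood.Theorems.GreenTaoLevelTwoMNTwoRotationBohrSize
import Summits.Parity.GeneralizedHardyLittlewood.Theorems.GreenTaoLevelTwoMNTwoRotationBohrDoubling
import Summits.Parity.GeneralizedHardyLittlewood.Theorems.GreenTaoLevelTwoMNTwoRotationBohrDivisible

/-!
# Route `GreenTaoLevelTwo`, crux `MNTwo` (stmt-Parity-21276), line `birth`, stub `stub_mnVertical`:
# Proposition 25 (GT 2008b §11): the diagonal major-arc property holds on a dense subset of a Bohr set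

Block V5 / H5 of the `stub_mnVertical` census (B. Green, T. Tao, *Quadratic uniformity of the
Möbius function*, Ann. Inst. Fourier 58 (2008) = arXiv:math/0606087, §11, Proposition 25: from the
conclusion of Proposition 22 at `X = 1/ρ₁` — a set `𝒟 ⊆ [1,D]`, `|𝒟| ≳ Dρ₁^{1/2}`, such that
`‖φ''(dw,dw)‖_{ℝ/ℤ,Q} ≲ ρ₁²` whenever `d ∈ 𝒟` and `dw ∈ B_g(0,ρ₁)` — one gets this property for
`≳ ρ₁^{3/2}|B_g(0,ρ₁)|` elements of `B_g(0,ρ₁)`: "if we define the sets `Ω := B_g(0,ρ₁) ∩ ℤ⁺`,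
`Ω_d := {n ∈ Ω : d | n}` … it will suffice … to prove `|⋃_{d∈𝒟} Ω_d| ≳ ρ₁^{3/2}|Ω|`.  Observing from
Lemma (bohr-size) that `|Ω| ≫ ρ₁^C N` and `|Ω_d| ≫ |Ω|/D` … it follows by taking `κ := 1/2C` in
Lemma (div-pack) …").

COMBINATORIAL, def-free form: the "major arc" property is an arbitrary decidable predicate `good`
on `ℤ` (in the application `good n ⇔ ∃ q ≤ Q, ‖qφ''(n,n)‖ ≤ ε`); the Bohr sets are the rotation
Bohr sets of `…MNTwoRotationBohrSize` (`{n : ‖nαᵢ‖ + |n|/N < ρ ∀ i, |n|/N < ρ} ∩ (−N,N)`);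
the output is the density of `{n ∈ B(ρ₁) : good n}` inside `B(2ρ₁)` — the hypothesis `σ#T ≤ #𝒮`
of `…MNTwoDiagonalMajorArc.diagonal_major_arc` (Lemma 26) with `T = B(2ρ₁)`.  Ingredients:
Lemma 14 (a),(b),(c) (tree: `card_rotationBohr_ge`, `card_rotationBohr_two_mul_le`,
`card_rotationBohr_dvd_ge`) and the divisor packing lemma (`…MNTwoDivisorPacking.divisor_packing`,
exponent `κ = 1/r` free).

* `neg_mem_rotationBohr` — the rotation Bohr sets are symmetric;
* `two_mul_card_pos_le`, `card_le_one_add_two_mul_card_pos` — a symmetric `B ⊆ (−N,N)` versus its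
  positive part `{m ∈ [1,N] : ↑m ∈ B}`;
* `dense_diagonal_set` — **Proposition 25**:
  `#{n ∈ B(ρ₁) : good n} ≥ (2·32·38ᵏ·D)⁻² · |𝒟|² · |B(2ρ₁)|/(4·32·38ᵏ) · ((ρ₁/16)^{k+1}/(8(1+log N)^{4^r}))^{1/r}`.

References: [GreenTao2008QuadraticMobius] arXiv:math/0606087 §11, Proposition 25; §3 Lemma 14.
-/

noncomputable section

open Finset Real

namespace Summit.Parity.GeneralizedHardyLittlewood.GreenTaoLevelTwoMNTwoDenseDiagonal

open Summit.Parity.GeneralizedHardyLittlewood.GreenTaoLevelTwoMNTwoDivisorPacking (divisor_packing)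
open Summit.Parity.GeneralizedHardyLittlewood.GreenTaoLevelTwoMNTwoRotationBohrSize
  (card_rotationBohr_ge)
open Summit.Parity.GeneralizedHardyLittlewood.GreenTaoLevelTwoMNTwoRotationBohrDoubling
  (card_rotationBohr_two_mul_le)
open Summit.Parity.GeneralizedHardyLittlewood.GreenTaoLevelTwoMNTwoRotationBohrDivisible
  (card_rotationBohr_dvd_ge)

/-! ### §1 Symmetric sets of integers and their positive parts -/

/-- The rotation Bohr sets are symmetric under `n ↦ −n`. [folklore] -/
theorem neg_mem_rotationBohr {k N : ℕ} (α : Fin k → ℝ) {ρ : ℝ} {n : ℤ}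
    (hn : n ∈ (Finset.Ioo (-(N : ℤ)) N).filter fun n : ℤ =>
      (∀ i, ‖(((n : ℝ) * α i : ℝ) : AddCircle (1 : ℝ))‖ + |(n : ℝ)| / N < ρ) ∧ |(n : ℝ)| / N < ρ) :
    -n ∈ (Finset.Ioo (-(N : ℤ)) N).filter fun n : ℤ =>
      (∀ i, ‖(((n : ℝ) * α i : ℝ) : AddCircle (1 : ℝ))‖ + |(n : ℝ)| / N < ρ) ∧ |(n : ℝ)| / N < ρ := by
  rw [mem_filter, mem_Ioo] at hn ⊢
  obtain ⟨⟨h1, h2⟩, h3, h4⟩ := hn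
  refine ⟨⟨by omega, by omega⟩, fun i => ?_, ?_⟩
  · have := h3 i
    push_cast
    rwa [neg_mul, AddCircle.coe_neg, norm_neg, abs_neg]
  · push_cast; rwa [abs_neg]

/-- For a symmetric finite `B ⊆ ℤ`, twice the size of its positive part `{m ∈ [1,N] : ↑m ∈ B}` is
at most `#B`. [folklore] -/
theorem two_mul_card_pos_le (N : ℕ) (B : Finset ℤ) (hB : ∀ n ∈ B, -n ∈ B) :
    2 * #((Icc 1 N).filter fun m : ℕ => (m : ℤ) ∈ B) ≤ #B := by
  classical
  set A := (Icc 1 N).filter fun m : ℕ => (m : ℤ) ∈ B with hA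
  have h1 : #(A.image fun m : ℕ => (m : ℤ)) = #A :=
    card_image_of_injective _ fun a b h => by simpa using h
  have h2 : #(A.image fun m : ℕ => -(m : ℤ)) = #A :=
    card_image_of_injective _ fun a b h => by simpa using h
  have hdisj : Disjoint (A.image fun m : ℕ => (m : ℤ)) (A.image fun m : ℕ => -(m : ℤ)) := by
    rw [Finset.disjoint_left]
    intro x hx hx'
    rw [mem_image] at hx hx'
    obtain ⟨a, ha, rfl⟩ := hx
    obtain ⟨b, hb, hab⟩ := hx'
    rw [hA, mem_filter, mem_Icc] at ha hb
    omega
  have hsub : (A.image fun m : ℕ => (m : ℤ)) ∪ (A.image fun m : ℕ => -(m : ℤ)) ⊆ B := by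
    intro x hx
    rw [mem_union, mem_image, mem_image] at hx
    rcases hx with ⟨a, ha, rfl⟩ | ⟨a, ha, rfl⟩
    · exact (mem_filter.1 ha).2
    · exact hB _ (mem_filter.1 ha).2
  have := card_le_card hsub
  rw [card_union_of_disjoint hdisj, h1, h2] at this
  omega

/-- For a symmetric finite `B ⊆ (−N, N)`, `#B ≤ 1 + 2 #{m ∈ [1,N] : ↑m ∈ B}`. [folklore] -/
theorem card_le_one_add_two_mul_card_pos (N : ℕ) (B : Finset ℤ) (hB : ∀ n ∈ B, -n ∈ B)
    (hBN : ∀ n ∈ B, -(N : ℤ) < n ∧ n < N) :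
    #B ≤ 1 + 2 * #((Icc 1 N).filter fun m : ℕ => (m : ℤ) ∈ B) := by
  classical
  set A := (Icc 1 N).filter fun m : ℕ => (m : ℤ) ∈ B with hA
  have hsub : B ⊆ insert (0 : ℤ) ((A.image fun m : ℕ => (m : ℤ)) ∪ (A.image fun m : ℕ => -(m : ℤ))) := by
    intro n hn
    rw [mem_insert, mem_union, mem_image, mem_image]
    have hN := hBN n hn
    rcases lt_trichotomy n 0 with hneg | h0 | hpos
    · right; right
      refine ⟨(-n).toNat, ?_, ?_⟩
      · rw [hA, mem_filter, mem_Icc]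
        have e : (((-n).toNat : ℕ) : ℤ) = -n := Int.toNat_of_nonneg (by omega)
        refine ⟨⟨by omega, by omega⟩, ?_⟩
        rw [e]; exact hB n hn
      · have e : (((-n).toNat : ℕ) : ℤ) = -n := Int.toNat_of_nonneg (by omega)
        rw [e, neg_neg]
    · left; exact h0
    · right; left
      refine ⟨n.toNat, ?_, ?_⟩
      · rw [hA, mem_filter, mem_Icc]
        have e : ((n.toNat : ℕ) : ℤ) = n := Int.toNat_of_nonneg (by omega)
        refine ⟨⟨by omega, by omega⟩, ?_⟩
        rw [e]; exact hn
      · exact Int.toNat_of_nonneg (by omega)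
  calc #B ≤ #(insert (0 : ℤ) ((A.image fun m : ℕ => (m : ℤ)) ∪ (A.image fun m : ℕ => -(m : ℤ)))) :=
        card_le_card hsub
    _ ≤ #((A.image fun m : ℕ => (m : ℤ)) ∪ (A.image fun m : ℕ => -(m : ℤ))) + 1 := card_insert_le _ _
    _ ≤ (#(A.image fun m : ℕ => (m : ℤ)) + #(A.image fun m : ℕ => -(m : ℤ))) + 1 := by
        gcongr; exact card_union_le _ _
    _ ≤ (#A + #A) + 1 := by gcongr <;> exact card_image_le
    _ = 1 + 2 * #A := by ring

/-! ### §2 Proposition 25 -/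

/-- **Proposition 25 (GT 2008b §11), combinatorial form.**  Let `B(ρ)` denote the rotation Bohr
set `{n ∈ (−N,N) : ‖nαᵢ‖ + |n|/N < ρ ∀ i, |n|/N < ρ}`, `0 < ρ₁ ≤ 1/4`, `1 ≤ D`, `𝒟 ⊆ [1,D]`, and
assume the size condition `4·32·38ᵏ·D ≤ (ρ₁/16)^{k+1}N/2` (so that `|B(ρ₁)| ≥ 4·32·38ᵏ·D`).  If a
property `good` holds at every multiple of every `d ∈ 𝒟` inside `B(ρ₁)` (the conclusion of
Proposition 22 at `X = 1/ρ₁`), then for every integer `r ≥ 1`,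
`#{n ∈ B(ρ₁) : good n} ≥ (2·32·38ᵏ·D)⁻²·|𝒟|²·(|B(2ρ₁)|/(4·32·38ᵏ))·((ρ₁/16)^{k+1}/(8(1+log N)^{4^r}))^{1/r}`.
With `|𝒟| ≥ c₀Dρ₁^{1/2}` and `r = 2(k+1)` this is `≳ c₀²ρ₁^{3/2}|B(2ρ₁)|` up to a power of `log N`,
as printed. [cite: GreenTao2008QuadraticMobius, §11, Proposition 25] -/
theorem dense_diagonal_set (k : ℕ) {N : ℕ} (hN : 1 ≤ N) (α : Fin k → ℝ) {ρ₁ : ℝ} (hρ : 0 < ρ₁)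
    (hρ4 : ρ₁ ≤ 1 / 4) {D : ℕ} (hD : 1 ≤ D) (𝒟 : Finset ℕ) (h𝒟 : 𝒟 ⊆ Icc 1 D)
    (hlarge : 4 * (32 * 38 ^ k) * (D : ℝ) ≤ (ρ₁ / 16) ^ (k + 1) * N / 2)
    (good : ℤ → Prop) [DecidablePred good]
    (hgood : ∀ d ∈ 𝒟, ∀ n ∈ (Finset.Ioo (-(N : ℤ)) N).filter fun n : ℤ =>
        (∀ i, ‖(((n : ℝ) * α i : ℝ) : AddCircle (1 : ℝ))‖ + |(n : ℝ)| / N < ρ₁) ∧ |(n : ℝ)| / N < ρ₁,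
      (d : ℤ) ∣ n → good n)
    {r : ℕ} (hr : 1 ≤ r) :
    (1 / (2 * (32 * 38 ^ k) * (D : ℝ))) ^ 2 * (#𝒟 : ℝ) ^ 2 *
        ((#((Finset.Ioo (-(N : ℤ)) N).filter fun n : ℤ =>
            (∀ i, ‖(((n : ℝ) * α i : ℝ) : AddCircle (1 : ℝ))‖ + |(n : ℝ)| / N < 2 * ρ₁) ∧
              |(n : ℝ)| / N < 2 * ρ₁) : ℝ) / (4 * (32 * 38 ^ k))) *
        (((ρ₁ / 16) ^ (k + 1) / 8) / (1 + Real.log N) ^ (4 ^ r)) ^ ((1 : ℝ) / r) ≤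
      #(((Finset.Ioo (-(N : ℤ)) N).filter fun n : ℤ =>
          (∀ i, ‖(((n : ℝ) * α i : ℝ) : AddCircle (1 : ℝ))‖ + |(n : ℝ)| / N < ρ₁) ∧
            |(n : ℝ)| / N < ρ₁).filter good) := by
  classical
  set C : ℝ := 32 * 38 ^ k with hC
  have hCpos : 0 < C := by rw [hC]; positivity
  have hC1 : 1 ≤ C := by rw [hC]; have : (1 : ℝ) ≤ 38 ^ k := one_le_pow₀ (by norm_num); nlinarith
  set B := (Finset.Ioo (-(N : ℤ)) N).filter fun n : ℤ =>
    (∀ i, ‖(((n : ℝ) * α i : ℝ) : AddCircle (1 : ℝ))‖ + |(n : ℝ)| / N < ρ₁) ∧ |(n : ℝ)| / N < ρ₁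
    with hB
  set B2 := (Finset.Ioo (-(N : ℤ)) N).filter fun n : ℤ =>
    (∀ i, ‖(((n : ℝ) * α i : ℝ) : AddCircle (1 : ℝ))‖ + |(n : ℝ)| / N < 2 * ρ₁) ∧
      |(n : ℝ)| / N < 2 * ρ₁ with hB2
  set A := (Icc 1 N).filter fun m : ℕ => (m : ℤ) ∈ B with hA
  have hNpos : (0 : ℝ) < N := by exact_mod_cast hN
  have hDpos : (0 : ℝ) < D := by exact_mod_cast hD
  have hlog : 0 ≤ 1 + Real.log N := by
    have : (1 : ℝ) ≤ N := by exact_mod_cast hN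
    linarith [Real.log_nonneg this]
  -- symmetry and size of `B`
  have hBsymm : ∀ n ∈ B, -n ∈ B := fun n hn => neg_mem_rotationBohr α hn
  have hBN : ∀ n ∈ B, -(N : ℤ) < n ∧ n < N := fun n hn => by
    have := (mem_filter.1 hn).1; rwa [mem_Ioo] at this
  have hBge : (ρ₁ / 16) ^ (k + 1) * N / 2 ≤ #B := card_rotationBohr_ge k hN α hρ (by linarith)
  have hB2le : (#B2 : ℝ) ≤ C * #B := card_rotationBohr_two_mul_le k hN α hρ hρ4
  have hA2 : 2 * (#A : ℝ) ≤ #B := by exact_mod_cast two_mul_card_pos_le N B hBsymm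
  have hA1 : (#B : ℝ) ≤ 1 + 2 * #A := by exact_mod_cast card_le_one_add_two_mul_card_pos N B hBsymm hBN
  have hBbig : 4 * C * D ≤ (#B : ℝ) := hlarge.trans hBge
  have hB2' : (2 : ℝ) ≤ #B := by
    have := mul_le_mul hC1 (show (1 : ℝ) ≤ D by exact_mod_cast hD) zero_le_one hCpos.le
    linarith
  have hAge : (#B : ℝ) / 4 ≤ #A := by
    rw [div_le_iff₀ (by norm_num : (0 : ℝ) < 4)]; linarith
  have hApos : (0 : ℝ) < #A := by linarith
  -- the divisibility density `δ = 1/(2CD)`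
  have hAsub : A ⊆ Icc 1 N := filter_subset _ _
  have hAd : ∀ d ∈ 𝒟, 1 / (2 * C * D) * #A ≤ #(A.filter fun m => d ∣ m) := by
    intro d hd
    have hd1 : 1 ≤ d := (mem_Icc.1 (h𝒟 hd)).1
    have hdD : (d : ℝ) ≤ D := by exact_mod_cast (mem_Icc.1 (h𝒟 hd)).2
    have hdpos : (0 : ℝ) < d := by exact_mod_cast hd1
    -- `B_d` and Lemma 14 (c)
    set Bd := (Finset.Ioo (-(N : ℤ)) N).filter fun n : ℤ =>
      ((∀ i, ‖(((n : ℝ) * α i : ℝ) : AddCircle (1 : ℝ))‖ + |(n : ℝ)| / N < ρ₁) ∧ |(n : ℝ)| / N < ρ₁) ∧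
        (d : ℤ) ∣ n with hBd
    have h14c : (#B : ℝ) ≤ C * d * #Bd := by
      have := card_rotationBohr_dvd_ge k hN α hρ (by linarith) hd1
      rw [hC]; exact this
    have hBdB : ∀ n ∈ Bd, n ∈ B ∧ (d : ℤ) ∣ n := fun n hn => by
      rw [hBd, mem_filter] at hn
      exact ⟨mem_filter.2 ⟨hn.1, hn.2.1⟩, hn.2.2⟩
    have hBdsymm : ∀ n ∈ Bd, -n ∈ Bd := fun n hn => by
      obtain ⟨hnB, hdn⟩ := hBdB n hn
      have h' := hBsymm n hnB
      rw [hBd, mem_filter]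
      rw [hB, mem_filter] at h'
      exact ⟨h'.1, h'.2, (dvd_neg).2 hdn⟩
    have hBdN : ∀ n ∈ Bd, -(N : ℤ) < n ∧ n < N := fun n hn => hBN n (hBdB n hn).1
    have hBd1 : (#Bd : ℝ) ≤ 1 + 2 * #((Icc 1 N).filter fun m : ℕ => (m : ℤ) ∈ Bd) := by
      exact_mod_cast card_le_one_add_two_mul_card_pos N Bd hBdsymm hBdN
    have hAdeq : ((Icc 1 N).filter fun m : ℕ => (m : ℤ) ∈ Bd) = A.filter fun m => d ∣ m := by
      rw [hA, Finset.filter_filter]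
      refine Finset.filter_congr fun m _ => ?_
      constructor
      · intro h
        obtain ⟨hmB, hdm⟩ := hBdB _ h
        exact ⟨hmB, by exact_mod_cast hdm⟩
      · rintro ⟨hmB, hdm⟩
        rw [hBd, mem_filter]
        rw [hB, mem_filter] at hmB
        exact ⟨hmB.1, hmB.2, by exact_mod_cast hdm⟩
    rw [hAdeq] at hBd1
    -- `#B/(Cd) ≤ #Bd ≤ 1 + 2#A_d`, `#B ≥ 4CD ≥ 4Cd`, `#A ≤ #B/2`
    have hCd : 0 < C * d := by positivity
    have h1 : (#B : ℝ) ≤ C * d * (1 + 2 * #(A.filter fun m => d ∣ m)) :=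
      h14c.trans (mul_le_mul_of_nonneg_left hBd1 hCd.le)
    have h2 : 4 * (C * d) ≤ (#B : ℝ) := by nlinarith
    rw [one_div, inv_mul_le_iff₀ (by positivity)]
    -- goal: `#A ≤ 2CD · #A_d`
    have h3 : (#B : ℝ) / 2 ≤ C * d * (2 * #(A.filter fun m => d ∣ m)) := by nlinarith
    have h4 : (#A : ℝ) ≤ C * d * (2 * #(A.filter fun m => d ∣ m)) := by linarith
    calc (#A : ℝ) ≤ C * d * (2 * #(A.filter fun m => d ∣ m)) := h4
      _ ≤ C * D * (2 * #(A.filter fun m => d ∣ m)) := by gcongr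
      _ = 2 * C * D * #(A.filter fun m => d ∣ m) := by ring
  -- divisor packing
  have hpack := divisor_packing N A hAsub 𝒟 (δ := 1 / (2 * C * D)) (by positivity) hAd hr
  -- `U ⊆ {n ∈ B : good n}` via `m ↦ ↑m`
  have hU : #(A.filter fun m => ∃ d ∈ 𝒟, d ∣ m) ≤ #(B.filter good) := by
    calc #(A.filter fun m => ∃ d ∈ 𝒟, d ∣ m)
        = #((A.filter fun m => ∃ d ∈ 𝒟, d ∣ m).image fun m : ℕ => (m : ℤ)) :=
          (card_image_of_injective _ fun a b h => by simpa using h).symm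
      _ ≤ #(B.filter good) := by
          refine card_le_card fun x hx => ?_
          rw [mem_image] at hx
          obtain ⟨m, hm, rfl⟩ := hx
          rw [mem_filter] at hm
          obtain ⟨hmA, d, hd, hdm⟩ := hm
          have hmB : (m : ℤ) ∈ B := (mem_filter.1 hmA).2
          exact mem_filter.2 ⟨hmB, hgood d hd _ hmB (by exact_mod_cast hdm)⟩
  have hU' : (#(A.filter fun m => ∃ d ∈ 𝒟, d ∣ m) : ℝ) ≤ #(B.filter good) := by exact_mod_cast hU
  refine le_trans ?_ (hpack.trans hU')
  -- monotonicity in `#A`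
  have hX : ((ρ₁ / 16) ^ (k + 1) / 8) / (1 + Real.log N) ^ (4 ^ r) ≤
      (#A : ℝ) / (N * (1 + Real.log N) ^ (4 ^ r)) := by
    rw [div_div, div_le_div_iff₀ (by positivity) (by positivity)]
    have h1 : (ρ₁ / 16) ^ (k + 1) / 8 * N ≤ #A := by linarith
    calc (ρ₁ / 16) ^ (k + 1) * (N * (1 + Real.log N) ^ (4 ^ r))
        = ((ρ₁ / 16) ^ (k + 1) / 8 * N) * (8 * (1 + Real.log N) ^ (4 ^ r)) := by ring
      _ ≤ #A * (8 * (1 + Real.log N) ^ (4 ^ r)) := mul_le_mul_of_nonneg_right h1 (by positivity)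
  have hX0 : 0 ≤ ((ρ₁ / 16) ^ (k + 1) / 8) / (1 + Real.log N) ^ (4 ^ r) := by positivity
  have hrpow := Real.rpow_le_rpow hX0 hX (by positivity : (0 : ℝ) ≤ 1 / r)
  have hB2A : (#B2 : ℝ) / (4 * C) ≤ #A := by
    rw [div_le_iff₀ (by positivity)]
    calc (#B2 : ℝ) ≤ C * #B := hB2le
      _ ≤ C * (4 * #A) := by gcongr; linarith
      _ = #A * (4 * C) := by ring
  have hcoef : 0 ≤ (1 / (2 * C * (D : ℝ))) ^ 2 * (#𝒟 : ℝ) ^ 2 := by positivity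
  calc (1 / (2 * C * (D : ℝ))) ^ 2 * (#𝒟 : ℝ) ^ 2 * ((#B2 : ℝ) / (4 * C)) *
        (((ρ₁ / 16) ^ (k + 1) / 8) / (1 + Real.log N) ^ (4 ^ r)) ^ ((1 : ℝ) / r)
      ≤ (1 / (2 * C * (D : ℝ))) ^ 2 * (#𝒟 : ℝ) ^ 2 * #A *
          ((#A : ℝ) / (N * (1 + Real.log N) ^ (4 ^ r))) ^ ((1 : ℝ) / r) := by
        gcongr
    _ = (1 / (2 * C * (D : ℝ))) ^ 2 * (#𝒟 : ℝ) ^ 2 * #A *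
          ((#A : ℝ) / (N * (1 + Real.log N) ^ (4 ^ r))) ^ ((1 : ℝ) / r) := rfl

end Summit.Parity.GeneralizedHardyLittlewood.GreenTaoLevelTwoMNTwoDenseDiagonal
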